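import Mathlib
import Summits.Schanuel.Schanuel.Statement
import Literature.NumberTheory.Transcendental.RoyCriterion
import Literature.NumberTheory.Transcendental.RoyCriterionProofs
import Literature.NumberTheory.Transcendental.RoyCriterionThm3Proofs
import HarnessLib

/-!
# Dirichlet's box principle for the `D`-jets of an integer polynomial at arbitrary points

`Summits/Schanuel/Schanuel/Theorems/SoloBlindJetBoxPrinciple.lean` (soloist `solo-Schanuel-blind`,
session 12; first of three files, see `SoloBlindSubDirichlet.lean` for the statement they serve:
Roy's hypothesis (Acta Arith. 97 (2001), Conjecture 2) is void below the Dirichlet exponent).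

Roy's derivation `D = ∂₀ + X₁∂₁` on `ℤ[X₀, X₁]` is the vector field of the one-parameter group
`w ↦ (ξ + w, η e^w)` through EVERY point `(ξ, η) ∈ ℂ²`, not only through `(0, 1)`:
`(d/dw)^k P(ξ + w, η e^w) = (D^k P)(ξ + w, η e^w)` (`iteratedDeriv_shiftEval`; the tree has the case
`(ξ, η) = (0, 1)`, `iteratedDeriv_expEval`).  Hence Cauchy's estimate bounds the jet coefficients
`|(D^k X₀^a X₁^b)(ξ, η)| ≤ k! (‖ξ‖+1)^a (e‖η‖)^b` at an arbitrary point
(`norm_jetAt_monoXY_le`), and Dirichlet's box principle for real linear forms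
(`exists_ne_zero_int_forms_le`, Waldschmidt 1981, Lemme 3.3, in the tree) yields
`exists_polyOfCoeffs_jets_le`: for ANY finite set of points `(ξᵢ, ηᵢ)` and integers
`T₀, T₁, K, X, ℓ` with `ℓ^{2(K+1)#ι} < (X+1)^{(T₀+1)(T₁+1)}` there is `0 ≠ P ∈ ℤ[X₀,X₁]` of
partial degrees `≤ T₀, T₁`, height `≤ X`, all of whose jets `(D^k P)(ξᵢ, ηᵢ)`, `k ≤ K`, are
`≤ 2X·K!(T₀+1)(T₁+1)(R+1)^{T₀}R₁^{T₁}/ℓ` (`‖ξᵢ‖ ≤ R`, `e‖ηᵢ‖ ≤ R₁`).  Nothing relates the points to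
the exponential map.  Also two elementary bounds for the points of Roy's translation box
(`norm_sum_natMul_le`, `norm_prod_pow_le`).

References: D. Roy, Acta Arith. 97 (2001) 183–194, §§4–5; M. Waldschmidt, Invent. Math. 63
(1981), §3, Lemme 3.3.
-/

noncomputable section

open Filter Complex MvPolynomial Metric

namespace Summit.Schanuel.Schanuel.Theorems

open Literature.NumberTheory.Transcendental

/-! ### Evaluation along the translated exponential curve `w ↦ (ξ + w, η e^w)` -/

/-- `g(w) = P(ξ + w, η e^w)`: the polynomial `P` evaluated along the translate through `(ξ, η)` of
the exponential curve (for `(ξ, η) = (0, 1)` this is `expEval P`). [this work] -/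
def shiftEval (ξ η : ℂ) (P : MvPolynomial (Fin 2) ℤ) (w : ℂ) : ℂ :=
  aeval ![ξ + w, η * cexp w] P

/-- At `w = 0` the translated evaluation is the value at `(ξ, η)`. [this work] -/
theorem shiftEval_zero (ξ η : ℂ) (P : MvPolynomial (Fin 2) ℤ) :
    shiftEval ξ η P 0 = aeval ![ξ, η] P := by
  simp [shiftEval]

/-- `d/dw P(ξ + w, η e^w) = (D P)(ξ + w, η e^w)` with `D = ∂₀ + X₁ ∂₁` (chain rule).
[this work; cf. Roy 2001, §4] -/
theorem hasDerivAt_shiftEval (ξ η : ℂ) (P : MvPolynomial (Fin 2) ℤ) (w : ℂ) :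
    HasDerivAt (shiftEval ξ η P) (shiftEval ξ η (royD P) w) w := by
  induction P using MvPolynomial.induction_on with
  | C a =>
    have h1 : shiftEval ξ η (C a) = fun _ => (a : ℂ) := by ext w; simp [shiftEval]
    have h2 : shiftEval ξ η (royD (C a)) w = 0 := by simp only [shiftEval, royD_C, map_zero]
    rw [h1, h2]
    exact hasDerivAt_const _ _
  | add p q hp hq =>
    have h1 : shiftEval ξ η (p + q) = fun w => shiftEval ξ η p w + shiftEval ξ η q w := by
      ext w; simp [shiftEval]
    have h2 : shiftEval ξ η (royD (p + q)) w =
        shiftEval ξ η (royD p) w + shiftEval ξ η (royD q) w := by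
      simp [shiftEval]
    rw [h1, h2]
    exact hp.add hq
  | mul_X p i hp =>
    have key : ∀ j : Fin 2, j = 0 ∨ j = 1 := by decide
    rcases key i with rfl | rfl
    · have h1 : shiftEval ξ η (p * X 0) = fun w => shiftEval ξ η p w * (ξ + w) := by
        ext w; simp [shiftEval]
      have h2 : shiftEval ξ η (royD (p * X 0)) w =
          shiftEval ξ η (royD p) w * (ξ + w) + shiftEval ξ η p w * 1 := by
        simp [shiftEval, royD_mul, map_add, map_mul]
      rw [h1, h2]
      exact hp.mul ((hasDerivAt_id w).const_add ξ)
    · have h1 : shiftEval ξ η (p * X 1) = fun w => shiftEval ξ η p w * (η * cexp w) := by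
        ext w; simp [shiftEval]
      have h2 : shiftEval ξ η (royD (p * X 1)) w =
          shiftEval ξ η (royD p) w * (η * cexp w) + shiftEval ξ η p w * (η * cexp w) := by
        simp [shiftEval, royD_mul, map_add, map_mul]
      rw [h1, h2]
      exact hp.mul ((Complex.hasDerivAt_exp w).const_mul η)

/-- `w ↦ P(ξ + w, η e^w)` is entire. [this work] -/
theorem differentiable_shiftEval (ξ η : ℂ) (P : MvPolynomial (Fin 2) ℤ) :
    Differentiable ℂ (shiftEval ξ η P) :=
  fun w => (hasDerivAt_shiftEval ξ η P w).differentiableAt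

/-- `(d/dw)^k P(ξ + w, η e^w) = (D^k P)(ξ + w, η e^w)`: the derivation `D` is the vector field of
the one-parameter group `w ↦ (ξ + w, η e^w)` through every point, not only through `(0, 1)`.
[this work; cf. Roy 2001, §5] -/
theorem iteratedDeriv_shiftEval (ξ η : ℂ) (k : ℕ) (P : MvPolynomial (Fin 2) ℤ) :
    iteratedDeriv k (shiftEval ξ η P) = shiftEval ξ η (royD^[k] P) := by
  induction k generalizing P with
  | zero => simp
  | succ k ih =>
    rw [iteratedDeriv_succ', show deriv (shiftEval ξ η P) = shiftEval ξ η (royD P) from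
      funext fun w => (hasDerivAt_shiftEval ξ η P w).deriv, ih, Function.iterate_succ_apply]

/-- Cauchy's estimate at an arbitrary point: if `|P(ξ + w, η e^w)| ≤ C` on `|w| = 1` then
`|(D^k P)(ξ, η)| ≤ k! C`. [this work] -/
theorem norm_jetAt_le_of_sphere (ξ η : ℂ) (k : ℕ) (P : MvPolynomial (Fin 2) ℤ) {C : ℝ}
    (hC : ∀ w ∈ sphere (0 : ℂ) 1, ‖shiftEval ξ η P w‖ ≤ C) :
    ‖aeval ![ξ, η] (royD^[k] P)‖ ≤ k.factorial * C := by
  have h := Complex.norm_iteratedDeriv_le_of_forall_mem_sphere_norm_le (f := shiftEval ξ η P) k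
    one_pos (differentiable_shiftEval ξ η P).diffContOnCl hC
  rw [iteratedDeriv_shiftEval, shiftEval_zero] at h
  simpa using h

/-- The monomial `X₀^a X₁^b` along the translate: `(ξ + w)^a (η e^w)^b`. [this work] -/
theorem shiftEval_monoXY (ξ η : ℂ) (a b : ℕ) (w : ℂ) :
    shiftEval ξ η (monoXY a b) w = (ξ + w) ^ a * (η * cexp w) ^ b := by
  simp [shiftEval, monoXY, map_mul, map_pow]

/-- On `|w| = 1`: `|(ξ + w)^a (η e^w)^b| ≤ (‖ξ‖ + 1)^a (‖η‖ e)^b`. [this work] -/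
theorem norm_shiftEval_monoXY_le (ξ η : ℂ) (a b : ℕ) {w : ℂ} (hw : w ∈ sphere (0 : ℂ) 1) :
    ‖shiftEval ξ η (monoXY a b) w‖ ≤ (‖ξ‖ + 1) ^ a * (‖η‖ * Real.exp 1) ^ b := by
  have hw1 : ‖w‖ = 1 := by simpa using hw
  have hre : w.re ≤ 1 := hw1 ▸ Complex.re_le_norm w
  rw [shiftEval_monoXY, norm_mul, norm_pow, norm_pow, norm_mul, Complex.norm_exp]
  have h1 : ‖ξ + w‖ ≤ ‖ξ‖ + 1 := hw1 ▸ norm_add_le ξ w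
  have h2 : ‖η‖ * Real.exp w.re ≤ ‖η‖ * Real.exp 1 :=
    mul_le_mul_of_nonneg_left (Real.exp_le_exp.2 hre) (norm_nonneg _)
  gcongr

/-- **Cauchy bound for the `D`-derivatives of a monomial at an arbitrary point**:
`|(D^k X₀^a X₁^b)(ξ, η)| ≤ k! (‖ξ‖ + 1)^a (e‖η‖)^b`. [this work] -/
theorem norm_jetAt_monoXY_le (ξ η : ℂ) (k a b : ℕ) :
    ‖aeval ![ξ, η] (royD^[k] (monoXY a b))‖ ≤
      k.factorial * ((‖ξ‖ + 1) ^ a * (‖η‖ * Real.exp 1) ^ b) :=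
  norm_jetAt_le_of_sphere ξ η k (monoXY a b) fun _ hw => norm_shiftEval_monoXY_le ξ η a b hw

/-! ### The box principle for the `D`-jets of an integer polynomial at finitely many points -/

/-- The value `(D^k P)(p)` for `P = Σ t(a,b) X₀^a X₁^b` is the linear form
`Σ t(a,b) · (D^k X₀^a X₁^b)(p)` in the coefficient vector `t`. [this work] -/
theorem jetAt_polyOfCoeffs_eq_sum {T₀ T₁ : ℕ} (t : Fin (T₀ + 1) × Fin (T₁ + 1) → ℤ)
    (k : ℕ) (p : Fin 2 → ℂ) :
    aeval p (royD^[k] (polyOfCoeffs t)) =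
      ∑ ab, (t ab : ℂ) * aeval p (royD^[k] (monoXY ab.1 ab.2)) := by
  unfold polyOfCoeffs
  rw [iterate_royD_sum, map_sum]
  refine Finset.sum_congr rfl fun ab _ => ?_
  rw [iterate_royD_C_mul, map_mul, MvPolynomial.aeval_C]
  simp

/-- **Box principle for `D`-jets at finitely many points.** Let `(ξᵢ, ηᵢ)_{i ∈ ι}` be finitely
many points of `ℂ²` with `‖ξᵢ‖ ≤ R` and `e‖ηᵢ‖ ≤ R₁` (`R₁ ≥ 1`), and let `T₀, T₁, K, X, ℓ ≥ 1` be
integers with `ℓ^{2(K+1)#ι} < (X+1)^{(T₀+1)(T₁+1)}`.  Then there is a non-zero coefficient vector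
`t` on the box `[0,T₀] × [0,T₁]`, `|t| ≤ X`, whose polynomial `P = Σ t(a,b)X₀^aX₁^b` has ALL jets
`|(D^k P)(ξᵢ, ηᵢ)| ≤ 2XA/ℓ` for `k ≤ K`, `i ∈ ι`, where `A = K!(T₀+1)(T₁+1)(R+1)^{T₀}R₁^{T₁}`.
(Dirichlet's box principle `exists_ne_zero_int_forms_le` applied to the `2(K+1)#ι` real linear
forms `t ↦ Re/Im (D^k P)(ξᵢ,ηᵢ)`, whose coefficients are bounded by the Cauchy estimate
`norm_jetAt_monoXY_le`.)  No hypothesis relates the points to the exponential map.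
[this work] -/
theorem exists_polyOfCoeffs_jets_le {ι : Type*} [Fintype ι] (ξ η : ι → ℂ) (T₀ T₁ K X ℓ : ℕ)
    {R R₁ : ℝ} (hR : ∀ i, ‖ξ i‖ ≤ R) (hR₁ : ∀ i, ‖η i‖ * Real.exp 1 ≤ R₁) (hR₁1 : 1 ≤ R₁)
    (hℓ : 0 < ℓ) (hcount : ℓ ^ (2 * ((K + 1) * Fintype.card ι)) < (X + 1) ^ ((T₀ + 1) * (T₁ + 1))) :
    ∃ t : Fin (T₀ + 1) × Fin (T₁ + 1) → ℤ, t ≠ 0 ∧ (∀ ab, |t ab| ≤ X) ∧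
      ∀ k ≤ K, ∀ i, ‖aeval ![ξ i, η i] (royD^[k] (polyOfCoeffs t))‖ ≤
        2 * (X * (K.factorial * ((((T₀ + 1) * (T₁ + 1) : ℕ) : ℝ) * ((R + 1) ^ T₀ * R₁ ^ T₁))) / ℓ) := by
  classical
  -- the jet coefficients `c (k,i) (a,b) = (D^k X₀^aX₁^b)(ξ_i, η_i)` and the real forms
  set c : Fin (K + 1) × ι → Fin (T₀ + 1) × Fin (T₁ + 1) → ℂ := fun ki ab =>
    aeval ![ξ ki.2, η ki.2] (royD^[(ki.1 : ℕ)] (monoXY ab.1 ab.2)) with hc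
  set u : (Fin (K + 1) × ι) × Fin 2 → Fin (T₀ + 1) × Fin (T₁ + 1) → ℝ := fun q ab =>
    if q.2 = 0 then (c q.1 ab).re else (c q.1 ab).im with hu
  have hcard : ℓ ^ Fintype.card ((Fin (K + 1) × ι) × Fin 2) <
      (X + 1) ^ Fintype.card (Fin (T₀ + 1) × Fin (T₁ + 1)) := by
    have e1 : Fintype.card ((Fin (K + 1) × ι) × Fin 2) = 2 * ((K + 1) * Fintype.card ι) := by
      simp only [Fintype.card_prod, Fintype.card_fin]; ring
    have e2 : Fintype.card (Fin (T₀ + 1) × Fin (T₁ + 1)) = (T₀ + 1) * (T₁ + 1) := by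
      simp only [Fintype.card_prod, Fintype.card_fin]
    rw [e1, e2]; exact hcount
  obtain ⟨t, ht0, htX, hforms⟩ := exists_ne_zero_int_forms_le u X ℓ hℓ hcard
  refine ⟨t, ht0, htX, fun k hk i => ?_⟩
  set A : ℝ := K.factorial * ((((T₀ + 1) * (T₁ + 1) : ℕ) : ℝ) * ((R + 1) ^ T₀ * R₁ ^ T₁)) with hA
  set kk : Fin (K + 1) := ⟨k, Nat.lt_succ_of_le hk⟩ with hkk
  have hR0 : 0 ≤ R := (norm_nonneg _).trans (hR i)
  -- the Cauchy bound on the coefficients of the forms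
  have hcoef : ∀ ab : Fin (T₀ + 1) × Fin (T₁ + 1), ‖c (kk, i) ab‖ ≤
      K.factorial * ((R + 1) ^ T₀ * R₁ ^ T₁) := by
    intro ab
    have h1 : (k.factorial : ℝ) ≤ K.factorial := by exact_mod_cast Nat.factorial_le hk
    have h2 : (‖ξ i‖ + 1) ^ (ab.1 : ℕ) ≤ (R + 1) ^ T₀ :=
      calc (‖ξ i‖ + 1) ^ (ab.1 : ℕ) ≤ (R + 1) ^ (ab.1 : ℕ) := by gcongr; exact hR i
        _ ≤ (R + 1) ^ T₀ := pow_le_pow_right₀ (by linarith) (Nat.lt_succ_iff.1 ab.1.isLt)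
    have h3 : (‖η i‖ * Real.exp 1) ^ (ab.2 : ℕ) ≤ R₁ ^ T₁ :=
      calc (‖η i‖ * Real.exp 1) ^ (ab.2 : ℕ) ≤ R₁ ^ (ab.2 : ℕ) := by gcongr; exact hR₁ i
        _ ≤ R₁ ^ T₁ := pow_le_pow_right₀ hR₁1 (Nat.lt_succ_iff.1 ab.2.isLt)
    calc ‖c (kk, i) ab‖
        ≤ k.factorial * ((‖ξ i‖ + 1) ^ (ab.1 : ℕ) * (‖η i‖ * Real.exp 1) ^ (ab.2 : ℕ)) :=
          norm_jetAt_monoXY_le _ _ _ _ _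
      _ ≤ K.factorial * ((R + 1) ^ T₀ * R₁ ^ T₁) :=
          mul_le_mul h1 (mul_le_mul h2 h3 (by positivity) (by positivity)) (by positivity)
            (by positivity)
  have hsum : ∀ s : Fin 2, ∑ ab, |u ((kk, i), s) ab| ≤ A := by
    intro s
    calc ∑ ab, |u ((kk, i), s) ab| ≤ ∑ ab, ‖c (kk, i) ab‖ := by
          refine Finset.sum_le_sum fun ab _ => ?_
          simp only [hu]
          split_ifs
          · exact Complex.abs_re_le_norm _
          · exact Complex.abs_im_le_norm _
      _ ≤ ∑ _ab : Fin (T₀ + 1) × Fin (T₁ + 1), (K.factorial : ℝ) * ((R + 1) ^ T₀ * R₁ ^ T₁) :=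
          Finset.sum_le_sum fun ab _ => hcoef ab
      _ = A := by
          rw [Finset.sum_const, Finset.card_univ, nsmul_eq_mul, hA]
          simp only [Fintype.card_prod, Fintype.card_fin]
          ring
  -- the value is `(form 0) + i (form 1)`
  have hval : aeval ![ξ i, η i] (royD^[k] (polyOfCoeffs t)) = ∑ ab, (t ab : ℂ) * c (kk, i) ab :=
    jetAt_polyOfCoeffs_eq_sum t k _
  have h10 : (1 : Fin 2) ≠ 0 := by decide
  have hre : (aeval ![ξ i, η i] (royD^[k] (polyOfCoeffs t))).re = ∑ ab, u ((kk, i), 0) ab * t ab := by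
    rw [hval, Complex.re_sum]
    refine Finset.sum_congr rfl fun ab _ => ?_
    simp only [hu, if_pos rfl, Complex.mul_re, Complex.intCast_re, Complex.intCast_im, zero_mul,
      sub_zero]
    ring
  have him : (aeval ![ξ i, η i] (royD^[k] (polyOfCoeffs t))).im = ∑ ab, u ((kk, i), 1) ab * t ab := by
    rw [hval, Complex.im_sum]
    refine Finset.sum_congr rfl fun ab _ => ?_
    simp only [hu, if_neg h10, Complex.mul_im, Complex.intCast_re, Complex.intCast_im, zero_mul,
      add_zero]
    ring
  have hXA : ∀ s : Fin 2, |∑ ab, u ((kk, i), s) ab * t ab| ≤ X * A / ℓ := by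
    intro s
    calc |∑ ab, u ((kk, i), s) ab * t ab| ≤ (X : ℝ) * (∑ ab, |u ((kk, i), s) ab|) / ℓ := hforms _
      _ ≤ X * A / ℓ := by gcongr; exact hsum s
  calc ‖aeval ![ξ i, η i] (royD^[k] (polyOfCoeffs t))‖
      ≤ |(aeval ![ξ i, η i] (royD^[k] (polyOfCoeffs t))).re| +
          |(aeval ![ξ i, η i] (royD^[k] (polyOfCoeffs t))).im| :=
        Complex.norm_le_abs_re_add_abs_im _
    _ ≤ X * A / ℓ + X * A / ℓ := by rw [hre, him]; exact add_le_add (hXA 0) (hXA 1)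
    _ = 2 * (X * A / ℓ) := by ring

/-! ### The points of Roy's translation box -/

/-- A point of the translation box: `‖Σ_j m_j y_j‖ ≤ M Σ_j ‖y_j‖` for `m_j ≤ M`. [folklore] -/
theorem norm_sum_natMul_le {l : ℕ} (y : Fin l → ℂ) {M : ℕ} (m : Fin l → Fin (M + 1)) :
    ‖∑ j, ((m j : ℕ) : ℂ) * y j‖ ≤ M * ∑ j, ‖y j‖ := by
  calc ‖∑ j, ((m j : ℕ) : ℂ) * y j‖ ≤ ∑ j, ‖((m j : ℕ) : ℂ) * y j‖ := norm_sum_le _ _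
    _ ≤ ∑ j, (M : ℝ) * ‖y j‖ := by
        refine Finset.sum_le_sum fun j _ => ?_
        rw [norm_mul, Complex.norm_natCast]
        have : ((m j : ℕ) : ℝ) ≤ M := by exact_mod_cast Nat.lt_succ_iff.1 (m j).isLt
        exact mul_le_mul_of_nonneg_right this (norm_nonneg _)
    _ = M * ∑ j, ‖y j‖ := by rw [Finset.mul_sum]

/-- A point of the translation box: `‖Π_j α_j^{m_j}‖ ≤ (Π_j max(1, ‖α_j‖))^M` for `m_j ≤ M`.
[folklore] -/
theorem norm_prod_pow_le {l : ℕ} (α : Fin l → ℂ) {M : ℕ} (m : Fin l → Fin (M + 1)) :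
    ‖∏ j, α j ^ (m j : ℕ)‖ ≤ (∏ j, max 1 ‖α j‖) ^ M := by
  rw [norm_prod, ← Finset.prod_pow]
  refine Finset.prod_le_prod (fun j _ => norm_nonneg _) fun j _ => ?_
  rw [norm_pow]
  calc ‖α j‖ ^ (m j : ℕ) ≤ (max 1 ‖α j‖) ^ (m j : ℕ) :=
        pow_le_pow_left₀ (norm_nonneg _) (le_max_right _ _) _
    _ ≤ (max 1 ‖α j‖) ^ M := pow_le_pow_right₀ (le_max_left _ _) (Nat.lt_succ_iff.1 (m j).isLt)

end Summit.Schanuel.Schanuel.Theorems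

end
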